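import Summits.QuantumFields.YangMills.Theorems.FemtoTransferGapPhysL2Infinite
import Summits.QuantumFields.YangMills.Theorems.FemtoCutoffLadderThinningAveraged
import Summits.QuantumFields.YangMills.Theorems.FemtoCutoffLadderThinningHolonomy

/-!
# Route `FemtoCutoffLadder` — crux `PinnedUpStep` (stmt-QuantumFields-26925), skeleton «conjuncts»: the registered stub
# `stub_pinnedVarPos : PinnedVarPos` is FALSE AS STATED (no coupling window ⇒ the degenerate coarse kernel at `β' = 0`)

Seat `ym-line-sfw-p1` g12 (2026-08-28), director-ym R438(a) re-arm.  Rung R2b1 is the RECORD-label femto transfer gap — not infinite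
volume, not the Clay mass gap; this module refutes a route-internal sub-piece and proves no step of any renormalisation-group argument.

`PinnedVarPos` (planner ym-idea-1 g5, `Cruxes/PinnedUpStep/Lines/conjuncts.lean`) quantifies over ALL real couplings `β, β'` (no femto
window, no `L0`) and over EVERY normalised physical `φ' ⊥ Ω'` solving the pointwise eigen-equation at `secondValue`.  At `β' = 0` the
coarse transfer kernel is `K ≡ 1` (§1): `topValue = 1` with ground state `Ω' ≡ 1`, `secondValue = 0`, and EVERY mean-zero physical `φ'`
solves `∫ K φ' = secondValue · φ'`.  §2 builds such a `φ'` on the coarse torus `(ℤ/2)³`: the normalised DIFFERENCE of the `(0,1)`-plaquette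
observables at the origin and at `e₂` (displaced PERPENDICULAR to the plaquette plane) — physical, mean zero, `L²`-norm one (the product
Haar measure has full support and the two plaquettes are told apart by one link).  §3 is the exact lattice fact behind the failure, valid for
EVERY sub-octave pair `L' < L < 2L'`: the thinned coarse plaquette at `x' + e_k` (`k` outside the plaquette plane) IS the thinned coarse
plaquette at `x'` of the fine translate `τ_{−s(x'_k)e_k} U` (`s = thinSteps`), so the fine-translation AVERAGE annihilates the difference:
`Σ_v φ'(thin(τ_v U)) = 0`, `fbar ≡ 0`, `ψ ≡ 0`, and the claimed `⟨ψ,Ω⟩² < ⟨ψ,ψ⟩` reads `0 < 0`.  §4: `pinnedVarPos_false : ¬ PinnedVarPos`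
(the def's body verbatim; witness `L' = 2`, `L = 3`, `β = β' = 0`, `Ω ≡ 1`, `Ω' ≡ 1`).

CLASSIFICATION: misstated.  The same annihilation lemma says what survives: the translation average kills every coarse eigenfunction that
is a perpendicular-momentum (`p_k ≠ 0`) combination of plane-local observables, for every pair — so the `∀ φ'` form needs BOTH the window
(to exclude degenerate `secondValue` eigenspaces) AND zero momentum of `φ'` (critic Pc: `∃ φ'` / translation-invariant `φ'`).
No new definitions (the witness is written inline), no named facts, no `sorry`.
-/

set_option autoImplicit false

noncomputable section

open MeasureTheory
open Literature.MathematicalPhysics.QuantumFieldTheory (Site Edge GaugeConfig plaquetteHolonomy gaugeTransform)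
open Literature.MathematicalPhysics.QuantumFieldTheory.TorusTranslation
open Literature.MathematicalPhysics.QuantumLattice (transport pathEnd)
open Summit.QuantumFields.YangMills.Theorems.FemtoTransferGap
open Summit.QuantumFields.YangMills.Theorems.FemtoCutoffLadder.Thinning

namespace Summit.QuantumFields.YangMills.Theorems.FemtoCutoffLadder.PinnedVarPosWitness

/-! ## §1 The degenerate kernel at `β = 0`: `K ≡ 1`, `topValue = 1`, `secondValue = 0` -/

section BetaZero

variable {L : ℕ} [NeZero L]

/-- At `β = 0` the transfer kernel is identically `1`. [folklore] -/
theorem transferKernel_zero (U V : GaugeConfig 3 L SU2) : transferKernel su2Rep 0 U V = 1 := by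
  simp [transferKernel]

/-- At `β = 0` the transfer form factorises: `⟨ψ, K₀ φ⟩ = (∫ψ)(∫φ)`. [folklore] -/
theorem qform_zero (ψ φ : GaugeConfig 3 L SU2 → ℝ) :
    qform su2Rep (L := L) 0 ψ φ = (∫ U, ψ U ∂configMeasure SU2 L) * ∫ U, φ U ∂configMeasure SU2 L := by
  unfold qform
  simp only [transferKernel_zero, mul_one]
  simp_rw [integral_const_mul]
  rw [integral_mul_const]

/-- Jensen on the a-priori probability measure: `(∫ψ)² ≤ ⟨ψ,ψ⟩` for a physical test function. [folklore] -/
theorem sq_integral_le_l2 {ψ : GaugeConfig 3 L SU2 → ℝ} (hψ : IsPhys ψ) :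
    (∫ U, ψ U ∂configMeasure SU2 L) ^ 2 ≤ l2 ψ ψ := by
  set m : ℝ := ∫ U, ψ U ∂configMeasure SU2 L with hm
  have hI := hψ.integrable
  have hI2 : Integrable (fun U => ψ U * ψ U) (configMeasure SU2 L) := by
    have := hψ.integrable_sq; simpa only [sq] using this
  have h0 : 0 ≤ ∫ U, (ψ U - m) * (ψ U - m) ∂configMeasure SU2 L := integral_nonneg fun U => mul_self_nonneg _
  have hexp : ∫ U, (ψ U - m) * (ψ U - m) ∂configMeasure SU2 L = l2 ψ ψ - m ^ 2 := by
    have he : (fun U => (ψ U - m) * (ψ U - m)) = fun U => ψ U * ψ U - (2 * m) * ψ U + m ^ 2 := by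
      funext U; ring
    have hB : Integrable (fun U => 2 * m * ψ U) (configMeasure SU2 L) := hI.const_mul _
    have hA : Integrable (fun U => ψ U * ψ U - 2 * m * ψ U) (configMeasure SU2 L) := hI2.sub hB
    rw [he, integral_add hA (integrable_const _), integral_sub hI2 hB, integral_const_mul]
    simp only [integral_const, smul_eq_mul, probReal_univ, one_mul]
    unfold l2
    rw [← hm]
    ring
  linarith

/-- The `L²` pairing of the constant `1` with itself is `1`. [folklore] -/
theorem l2_one_one : l2 (G := SU2) (L := L) (fun _ => (1 : ℝ)) (fun _ => 1) = 1 := by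
  unfold l2; simp

/-- ★ At `β = 0`, `topValue = 1` (Rayleigh quotients are `(∫ψ)²/⟨ψ,ψ⟩ ≤ 1`, with equality at `ψ ≡ 1`). [folklore] -/
theorem topValue_zero : topValue su2Rep L 0 = 1 := by
  unfold topValue
  refine IsGreatest.csSup_eq ⟨?_, ?_⟩
  · refine ⟨fun _ => 1, isPhys_const 1, trivial, by rw [l2_one_one (L := L)]; exact one_pos, ?_⟩
    rw [qform_zero, l2_one_one (L := L)]
    simp
  · rintro r ⟨ψ, hψ, -, hpos, rfl⟩
    rw [qform_zero, div_le_one hpos, ← sq]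
    exact sq_integral_le_l2 hψ

/-- ★ At `β = 0`, `secondValue = 0` (test functions orthogonal to `1` have mean zero, hence vanishing quotient; all quotients are `≥ 0`).
[folklore] -/
theorem secondValue_zero : secondValue su2Rep L 0 = 0 := by
  unfold secondValue
  refine IsLeast.csInf_eq ⟨?_, ?_⟩
  · refine ⟨fun _ => 1, isPhys_const 1, ?_⟩
    symm
    have hsub : ∀ r ∈ rayleighSet su2Rep L 0 (fun ψ => l2 ψ (fun _ => (1 : ℝ)) = 0), r = 0 := by
      rintro r ⟨ψ, hψ, horth, hpos, rfl⟩
      have hmean : ∫ U, ψ U ∂configMeasure SU2 L = 0 := by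
        unfold l2 at horth; simpa using horth
      rw [qform_zero, hmean, zero_mul, zero_div]
    exact le_antisymm (Real.sSup_le (fun r hr => (hsub r hr).le) le_rfl) (Real.sSup_nonneg fun r hr => (hsub r hr).ge)
  · rintro s ⟨φ, hφ, rfl⟩
    refine Real.sSup_nonneg ?_
    rintro r ⟨ψ, hψ, -, hpos, rfl⟩
    rw [qform_zero]
    exact div_nonneg (mul_self_nonneg _) hpos.le

/-- At `β = 0` the constant `1` solves the pointwise eigen-equation at `topValue`. [folklore] -/
theorem eigen_one_zero (U : GaugeConfig 3 L SU2) :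
    ∫ V, transferKernel su2Rep 0 U V * (fun _ => (1 : ℝ)) V ∂configMeasure SU2 L = topValue su2Rep L 0 * (fun _ => (1 : ℝ)) U := by
  simp [transferKernel_zero, topValue_zero]

/-- At `β = 0` every mean-zero function solves the pointwise eigen-equation at `secondValue`. [folklore] -/
theorem eigen_of_mean_zero {φ : GaugeConfig 3 L SU2 → ℝ} (hφ : ∫ V, φ V ∂configMeasure SU2 L = 0) (U : GaugeConfig 3 L SU2) :
    ∫ V, transferKernel su2Rep 0 U V * φ V ∂configMeasure SU2 L = secondValue su2Rep L 0 * φ U := by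
  simp [transferKernel_zero, secondValue_zero, hφ]

end BetaZero

/-! ## §2 The thinned coarse plaquette displaced perpendicular to its plane is a fine translate (every sub-octave pair) -/

section Shape

variable {L L' : ℕ} [NeZero L']

omit [NeZero L'] in
/-- A coarse site shifted along `k` has the same `d`-coordinate (`d ≠ k`). [folklore] -/
theorem shift_apply_of_ne (z' : Site 3 L') {k d : Fin 3} (hdk : d ≠ k) : (z'.shift k) d = z' d := by
  simp [Site.shift, Pi.single_eq_of_ne hdk]

omit [NeZero L'] in
/-- Shifts of sites commute. [folklore] -/
theorem shift_shift_comm (z' : Site 3 L') (k d : Fin 3) : (z'.shift k).shift d = (z'.shift d).shift k := by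
  simp only [Site.shift]
  abel

/-- **One thinned link at a `k`-shifted coarse site is the same link of the thinning of a fine translate**: for `d ≠ k`,
`(thin U)(z' + e_k, d) = (thin (τ_{−s e_k} U))(z', d)` with `s = thinSteps (z'_k)` (the path of the link starts `s` fine steps further
along `k` and has the same length). [folklore] -/
theorem thin_apply_shift (hLL : L' ≤ L) (h2 : L ≤ 2 * L') (U : GaugeConfig 3 L SU2) (z' : Site 3 L') {k d : Fin 3} (hdk : d ≠ k) :
    thin L' U (z'.shift k, d) =
      thin L' (torusConfigShift (-(Pi.single k ((thinSteps L L' (z' k) : ℕ) : ZMod L))) U : GaugeConfig 3 L SU2) (z', d) := by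
  show transport U (thinSite L (z'.shift k)) (List.replicate (thinSteps L L' ((z'.shift k) d)) d) =
    transport (torusConfigShift _ U : GaugeConfig 3 L SU2) (thinSite L z') (List.replicate (thinSteps L L' (z' d)) d)
  rw [shift_apply_of_ne z' hdk, thinSite_shift hLL h2 z' k, pathEnd_replicate, transport_torusConfigShift, sub_neg_eq_add]

/-- ★ **The thinned coarse plaquette at `x' + e_k` (`k` outside the plaquette plane `(i,j)`) IS the thinned coarse plaquette at `x'` of the
fine translate `τ_{−s(x'_k) e_k} U`** — all four links sit at coarse sites with the same `k`-coordinate `x'_k`. [folklore] -/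
theorem plaquetteHolonomy_thin_shift (hLL : L' ≤ L) (h2 : L ≤ 2 * L') (U : GaugeConfig 3 L SU2) (x' : Site 3 L') {i j k : Fin 3}
    (hik : i ≠ k) (hjk : j ≠ k) :
    plaquetteHolonomy (thin L' U) (x'.shift k) i j =
      plaquetteHolonomy (thin L' (torusConfigShift (-(Pi.single k ((thinSteps L L' (x' k) : ℕ) : ZMod L))) U : GaugeConfig 3 L SU2))
        x' i j := by
  unfold plaquetteHolonomy
  rw [shift_shift_comm x' k i, shift_shift_comm x' k j, thin_apply_shift hLL h2 U x' hik, thin_apply_shift hLL h2 U (x'.shift i) hjk,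
    thin_apply_shift hLL h2 U (x'.shift j) hik, thin_apply_shift hLL h2 U x' hjk, shift_apply_of_ne x' hik.symm,
    shift_apply_of_ne x' hjk.symm]

end Shape

/-! ## §3 The witness on the coarse torus: a normalised difference of two translated plaquette observables -/

section Witness

variable {M : ℕ} [NeZero M]

omit [NeZero M] in
/-- Plaquette holonomies of a translated configuration are translated plaquette holonomies. [folklore] -/
theorem plaquetteHolonomy_torusConfigShift (w : Site 3 M) (V : GaugeConfig 3 M SU2) (x : Site 3 M) (i j : Fin 3) :
    plaquetteHolonomy (torusConfigShift w V : GaugeConfig 3 M SU2) x i j = plaquetteHolonomy V (x - w) i j := by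
  have hs : ∀ d : Fin 3, (x - w).shift d = x.shift d - w := fun d => by simp only [Site.shift]; abel
  unfold plaquetteHolonomy
  simp only [torusConfigShift_apply, hs]

/-- The difference `ψ − ψ ∘ τ_w` of a physical test function and its translate is physical. [folklore] -/
theorem isPhys_sub_shift {ψ : GaugeConfig 3 M SU2 → ℝ} (hψ : IsPhys ψ) (w : Site 3 M) :
    IsPhys fun V => ψ V - ψ (torusConfigShift w V) := by
  have hτ := hψ.comp_torusConfigShift w
  obtain ⟨C, hC⟩ := hψ.bounded
  refine ⟨hψ.measurable.sub hτ.measurable, ⟨C + C, fun V => ?_⟩, fun g V => ?_, fun k z hz V => ?_⟩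
  · exact (abs_sub _ _).trans (add_le_add (hC _) (hC _))
  · show ψ (gaugeTransform g V) - ψ (torusConfigShift w (gaugeTransform g V)) = ψ V - ψ (torusConfigShift w V)
    rw [hψ.gaugeInv, hτ.gaugeInv g V]
  · show ψ (twist k z V) - ψ (torusConfigShift w (twist k z V)) = ψ V - ψ (torusConfigShift w V)
    rw [hψ.zeroFlux k z hz, hτ.zeroFlux k z hz V]

/-- … and has mean zero (translation invariance of the a-priori measure). [folklore] -/
theorem integral_sub_shift {ψ : GaugeConfig 3 M SU2 → ℝ} (hψ : IsPhys ψ) (w : Site 3 M) :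
    ∫ V, (ψ V - ψ (torusConfigShift w V)) ∂configMeasure SU2 M = 0 := by
  rw [integral_sub hψ.integrable (hψ.comp_torusConfigShift w).integrable, integral_comp_torusConfigShift w ψ, sub_self]

/-- The `(0,1)`-plaquette observable at the origin is physical (tree `PhysL2.isPhys_plaqObs_pow` at exponent `1`). [cite: Luscher1983, §2] -/
theorem isPhys_plaqObs : IsPhys (PhysL2.plaqObs M) := by
  have h := PhysL2.isPhys_plaqObs_pow (L := M) 1
  simpa only [pow_one] using h

/-- `scalarPart (−1) = −1` (from the tree's `scalarPart_negOne_mul` at `U = 1`). [folklore] -/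
theorem scalarPart_negOne' : scalarPart negOne = -1 := by
  have h := scalarPart_negOne_mul 1
  have h1 : scalarPart (1 : SU2) = 1 := by simp [scalarPart_eq]
  rw [mul_one, h1] at h
  exact h

/-- **The two plaquettes are told apart by one link** (coarse torus `(ℤ/2)³`): on the configuration with `−1` on the link `(0, e₀)` and `1`
elsewhere, the `(0,1)`-plaquette at the origin has scalar part `−1` and the one at `e₂` has scalar part `1`. [folklore] -/
theorem plaqObs_sub_shift_ne_zero :
    ∃ V : GaugeConfig 3 2 SU2,
      PhysL2.plaqObs 2 V - PhysL2.plaqObs 2 (torusConfigShift (-(Pi.single 2 1 : Site 3 2)) V) ≠ 0 := by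
  classical
  refine ⟨fun e => if e = ((0 : Site 3 2), (0 : Fin 3)) then negOne else 1, ?_⟩
  have h1 : Site.shift (0 : Site 3 2) 1 ≠ 0 := by decide
  have h5 : Site.shift (0 : Site 3 2) 1 + Pi.single 2 1 ≠ (0 : Site 3 2) := by decide
  have h6 : (Pi.single 2 1 : Site 3 2) ≠ 0 := by decide
  have hs1 : scalarPart (1 : SU2) = 1 := by simp [scalarPart_eq]
  simp [PhysL2.plaqObs, plaquetteHolonomy, h1, h5, h6, scalarPart_negOne', hs1]
  norm_num

end Witness


/-! ## §3b Bridging to the inline thinning / shift written in the item (local copies; the tree's `thin_eq_pinnedInline` lives in a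
route-dependent module) -/

section Bridge

/-- The straight-line transporter as an `ofFn` product: `P_U(c; i^M) = ∏_{t<M} U(c + t e_i, i)`. [folklore] -/
theorem transport_replicate_eq_ofFn_prod {n : ℕ} (U : GaugeConfig 3 n SU2) (i : Fin 3) :
    ∀ (M : ℕ) (c : Site 3 n),
      transport U c (List.replicate M i) = (List.ofFn fun t : Fin M => U (c + Pi.single i ((t : ℕ) : ZMod n), i)).prod
  | 0, c => by simp [Literature.MathematicalPhysics.QuantumLattice.transport_nil]
  | M + 1, c => by
    rw [List.replicate_succ, Literature.MathematicalPhysics.QuantumLattice.transport_cons, transport_replicate_eq_ofFn_prod U i M,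
      List.ofFn_succ, List.prod_cons]
    have h0 : c + Pi.single i (((0 : Fin (M + 1)) : ℕ) : ZMod n) = c := by simp
    have hs : ∀ t : Fin M, c.shift i + Pi.single i ((t : ℕ) : ZMod n) = c + Pi.single i (((t.succ : ℕ)) : ZMod n) := by
      intro t
      simp only [Fin.val_succ, Nat.cast_succ, Pi.single_add, Site.shift]
      abel
    rw [h0]
    congr 1
    refine congrArg List.prod (congrArg List.ofFn (funext fun t => ?_))
    rw [hs t]

end Bridge

/-! ## §4 The annihilation by the fine-translation average, and the refutation -/

section Refutation

/-- ★ **The fine-translation average annihilates the displaced-plaquette difference, for EVERY sub-octave pair**: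
`Σ_{v ∈ Λ_L} [plaqObs − plaqObs ∘ τ'_{−e₂}](thin L' (τ_v U)) = 0` — the thinned plaquette at `e₂` is the thinned plaquette at `0` of the fine
translate `τ_{−s e₂} U` (`plaquetteHolonomy_thin_shift`), and `v ↦ −s e₂ + v` is a bijection of `Λ_L`. [folklore] -/
theorem sum_sub_shift_thin_eq_zero {L L' : ℕ} [NeZero L] [NeZero L'] (hLL : L' ≤ L) (h2 : L ≤ 2 * L') (U : GaugeConfig 3 L SU2) :
    ∑ v : Site 3 L, (PhysL2.plaqObs L' (thin L' (torusConfigShift v U : GaugeConfig 3 L SU2)) -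
      PhysL2.plaqObs L' (torusConfigShift (-(Pi.single 2 1 : Site 3 L')) (thin L' (torusConfigShift v U : GaugeConfig 3 L SU2)) :
        GaugeConfig 3 L' SU2)) = 0 := by
  rw [Finset.sum_sub_distrib, sub_eq_zero]
  symm
  -- the displaced plaquette, read through the fine translate
  have hshape : ∀ W : GaugeConfig 3 L SU2,
      PhysL2.plaqObs L' (torusConfigShift (-(Pi.single 2 1 : Site 3 L')) (thin L' W) : GaugeConfig 3 L' SU2) =
        PhysL2.plaqObs L' (thin L' (torusConfigShift (-(Pi.single 2 ((thinSteps L L' (0 : ZMod L') : ℕ) : ZMod L))) W :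
          GaugeConfig 3 L SU2)) := by
    intro W
    simp only [PhysL2.plaqObs]
    rw [plaquetteHolonomy_torusConfigShift, sub_neg_eq_add, zero_add,
      show (Pi.single 2 1 : Site 3 L') = Site.shift (0 : Site 3 L') 2 by simp [Site.shift],
      plaquetteHolonomy_thin_shift hLL h2 W 0 (show (0 : Fin 3) ≠ 2 by decide) (show (1 : Fin 3) ≠ 2 by decide)]
    rfl
  simp only [hshape, torusConfigShift_torusConfigShift]
  exact Fintype.sum_equiv (Equiv.addLeft (-(Pi.single 2 ((thinSteps L L' (0 : ZMod L') : ℕ) : ZMod L) : Site 3 L))) _ _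
    fun v => rfl

/-- ★★★ **`PinnedVarPos` (registered stub `stub_pinnedVarPos` of skeleton «conjuncts» on stmt-QuantumFields-26925) is FALSE as stated.**
Witness: `L' = 2`, `L = 3`, `β = β' = 0`, `Ω ≡ 1`, `Ω' ≡ 1`, `c' = 1`, `φ'` = the `L²`-normalised difference of the `(0,1)`-plaquette
observables at `0` and at `e₂` on `(ℤ/2)³`; every hypothesis holds (§1, §3) and the pulled-back trial observable vanishes identically (§4), so
the claimed `⟨ψ,Ω⟩² < ⟨ψ,ψ⟩` is `0 < 0`.  (The body below is the definition `Cruxes.PinnedUpStep.Conjuncts.PinnedVarPos`, verbatim.)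
[cite: Luscher1983, §2] -/
theorem pinnedVarPos_false : ¬ (∀ (L' : ℕ) [NeZero L'] (L : ℕ) [NeZero L], L' < L → L < 2 * L' → ∀ β β' : ℝ, ∀ Ω : Literature.MathematicalPhysics.QuantumFieldTheory.GaugeConfig 3 L SU2 → ℝ, IsPhys Ω → (∀ U, 0 < Ω U) → l2 Ω Ω = 1 → (∀ U, ∫ V, transferKernel su2Rep β U V * Ω V ∂(configMeasure SU2 L) = topValue su2Rep L β * Ω U) → ∀ Ω' : Literature.MathematicalPhysics.QuantumFieldTheory.GaugeConfig 3 L' SU2 → ℝ, IsPhys Ω' → ∀ c' : ℝ, 0 < c' → (∀ U', c' ≤ Ω' U') → l2 Ω' Ω' = 1 → (∀ U', ∫ V', transferKernel su2Rep β' U' V' * Ω' V' ∂(configMeasure SU2 L') = topValue su2Rep L' β' * Ω' U') → ∀ φ' : Literature.MathematicalPhysics.QuantumFieldTheory.GaugeConfig 3 L' SU2 → ℝ, IsPhys φ' → l2 φ' Ω' = 0 → l2 φ' φ' = 1 → (∀ U', ∫ V', transferKernel su2Rep β' U' V' * φ' V' ∂(configMeasure SU2 L') = secondValue su2Rep L'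 β' * φ' U') → let T : Literature.MathematicalPhysics.QuantumFieldTheory.GaugeConfig 3 L SU2 → Literature.MathematicalPhysics.QuantumFieldTheory.GaugeConfig 3 L' SU2 := fun U e' => (List.ofFn fun t : Fin (if (e'.1 e'.2).val < L - L' then 2 else 1) => U ((fun j => (((e'.1 j).val + min (e'.1 j).val (L - L') : ℕ) : ZMod L)) + Pi.single e'.2 ((t : ℕ) : ZMod L), e'.2)).prod; let fbar : Literature.MathematicalPhysics.QuantumFieldTheory.GaugeConfig 3 L SU2 → ℝ := fun U => (Fintype.card (Literature.MathematicalPhysics.QuantumFieldTheory.Site 3 L) : ℝ)⁻¹ * ∑ v : Literature.MathematicalPhysics.QuantumFieldTheory.Site 3 L, φ' (T fun e => U (e.1 - v, e.2)) / Ω' (T fun e => U (e.1 - v, e.2)); let ψ : Literature.MathematicalPhysics.QuantumFieldTheory.GaugeConfig 3 L SU2 → ℝ := fun U => fbar U * Ω U; l2 ψ Ω ^ 2 < l2 ψ ψ) := by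
  intro h
  -- the coarse witness `φ' = D/‖D‖` on `(ℤ/2)³`
  set D : GaugeConfig 3 2 SU2 → ℝ := fun V => PhysL2.plaqObs 2 V -
    PhysL2.plaqObs 2 (torusConfigShift (-(Pi.single 2 1 : Site 3 2)) V : GaugeConfig 3 2 SU2) with hDdef
  have hD : IsPhys D := isPhys_sub_shift isPhys_plaqObs _
  have hDmean : ∫ V, D V ∂configMeasure SU2 2 = 0 := integral_sub_shift isPhys_plaqObs _
  have hDcont : Continuous D := by
    have h2c : Continuous fun V : GaugeConfig 3 2 SU2 =>
        PhysL2.plaqObs 2 (torusConfigShift (-(Pi.single 2 1 : Site 3 2)) V : GaugeConfig 3 2 SU2) := by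
      have he : (fun V : GaugeConfig 3 2 SU2 =>
          PhysL2.plaqObs 2 (torusConfigShift (-(Pi.single 2 1 : Site 3 2)) V : GaugeConfig 3 2 SU2)) =
          fun V => scalarPart (plaquetteHolonomy V (0 - -(Pi.single 2 1 : Site 3 2)) 0 1) := by
        funext V; simp only [PhysL2.plaqObs, plaquetteHolonomy_torusConfigShift]
      rw [he]
      exact continuous_scalarPart.comp (PhysL2.continuous_plaquetteHolonomy _ 0 1)
    exact PhysL2.continuous_plaqObs.sub h2c
  obtain ⟨V₀, hV₀⟩ := plaqObs_sub_shift_ne_zero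
  have hNpos : 0 < l2 D D := by
    haveI := PhysL2.isOpenPosMeasure_configMeasure (L := 2)
    have hint : Integrable (fun V => D V * D V) (configMeasure SU2 2) := by
      have := hD.integrable_sq; simpa only [sq] using this
    unfold l2
    rw [integral_pos_iff_support_of_nonneg (fun V => mul_self_nonneg _) hint]
    have hopen : IsOpen {V : GaugeConfig 3 2 SU2 | D V ≠ 0} := isOpen_ne_fun hDcont continuous_const
    have hsub : {V : GaugeConfig 3 2 SU2 | D V ≠ 0} ⊆ Function.support fun V => D V * D V := fun V hV => by
      simpa [Function.mem_support] using hV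
    exact (hopen.measure_pos _ ⟨V₀, hV₀⟩).trans_le (measure_mono hsub)
  set c : ℝ := (Real.sqrt (l2 D D))⁻¹ with hcdef
  set φ' : GaugeConfig 3 2 SU2 → ℝ := fun V => c * D V with hφ'def
  have hφ' : IsPhys φ' := hD.smul c
  have hc2 : c * c * l2 D D = 1 := by
    rw [hcdef, ← mul_inv, Real.mul_self_sqrt hNpos.le, inv_mul_cancel₀ hNpos.ne']
  have hφ'norm : l2 φ' φ' = 1 := by
    unfold l2
    have he : (fun V => φ' V * φ' V) = fun V => (c * c) * (D V * D V) := by funext V; simp only [hφ'def]; ring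
    rw [he, integral_const_mul]
    exact hc2
  have hφ'mean : ∫ V, φ' V ∂configMeasure SU2 2 = 0 := by
    simp only [hφ'def, integral_const_mul, hDmean, mul_zero]
  have hφ'orth : l2 φ' (fun _ => (1 : ℝ)) = 0 := by
    unfold l2; simpa only [mul_one] using hφ'mean
  have hφ'eig : ∀ U' : GaugeConfig 3 2 SU2,
      ∫ V', transferKernel su2Rep 0 U' V' * φ' V' ∂configMeasure SU2 2 = secondValue su2Rep 2 0 * φ' U' :=
    eigen_of_mean_zero hφ'mean
  -- the pinned variance claim at the witness
  have key := h 2 3 (by norm_num) (by norm_num) 0 0 (fun _ => 1) (isPhys_const 1) (fun _ => one_pos) l2_one_one eigen_one_zero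
    (fun _ => 1) (isPhys_const 1) 1 one_pos (fun _ => le_rfl) l2_one_one eigen_one_zero φ' hφ' hφ'orth hφ'norm hφ'eig
  simp only [] at key
  -- the fine-translation average of the pulled-back witness vanishes identically (every `U`)
  have hzero : ∀ U : GaugeConfig 3 3 SU2, ∑ v : Site 3 3, φ' (thin 2 (torusConfigShift v U : GaugeConfig 3 3 SU2)) = 0 := by
    intro U
    have h0 := sum_sub_shift_thin_eq_zero (L := 3) (L' := 2) (by norm_num) (by norm_num) U
    simp only [hφ'def, ← Finset.mul_sum]
    rw [h0, mul_zero]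
  have hT : ∀ W : GaugeConfig 3 3 SU2, thin 2 W = fun e' : Edge 3 2 =>
      (List.ofFn fun t : Fin (if (e'.1 e'.2).val < 3 - 2 then 2 else 1) =>
        W ((fun j => (((e'.1 j).val + min (e'.1 j).val (3 - 2) : ℕ) : ZMod 3)) + Pi.single e'.2 ((t : ℕ) : ZMod 3), e'.2)).prod :=
    fun W => funext fun e' => transport_replicate_eq_ofFn_prod W e'.2 _ _
  have hS : ∀ (v : Site 3 3) (U : GaugeConfig 3 3 SU2), (torusConfigShift v U : GaugeConfig 3 3 SU2) = fun e => U (e.1 - v, e.2) :=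
    fun v U => funext fun e => torusConfigShift_apply v U e
  simp only [hS, hT] at hzero
  simp only [div_one, mul_one, hzero, mul_zero] at key
  simp [l2] at key

end Refutation

end Summit.QuantumFields.YangMills.Theorems.FemtoCutoffLadder.PinnedVarPosWitness

end
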